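import Summits.BirchSwinnertonDyer.BirchSwinnertonDyer.Theorems.CMKolyvaginAtInertTwoLowerBottomRungAtTwo
import Summits.BirchSwinnertonDyer.BirchSwinnertonDyer.Theorems.Rank1ResidualJetKolyvaginClassOrder
import Summits.BirchSwinnertonDyer.BirchSwinnertonDyer.Theorems.GenusKolyvaginAtTwoGenusPrimitiveSupplyAtTwoKolyvaginClassAtTwo
import HarnessLib

/-!
# Route `CMKolyvaginAtInertTwo`, crux `CMKolyvaginConjectureAtInertTwo` (stmt-BirchSwinnertonDyer-24648),
# stub `stub_positiveDepth` — KOLYVAGIN'S FIRST DESCENT STEP AT `p = 2` ON H₂: THE DEPTH DOES NOT GROW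
# AT A DEEP CM-INERT KOLYVAGIN PRIME (`m(ℓ) ≤ m(1)`)

Seat `leafhand-bsd-cmkolyvaginatinert-5` g0 (cell `bsd-eis`); helper `--supports stmt-BirchSwinnertonDyer-24648`
(also the first kernel theorem in the currency of the child R1 `CMKolyvaginDescentOfNontrivialShaTwo`, 28177).
THEOREMS ONLY: no definition, no named fact, no `sorry`.  BSD is NOT proved by any of this; the stub and the crux
stay OPEN.  CONDITIONAL, like the route's whole lower-bound engine, on Gross 1991 Prop. 3.7 (2) BY NAME
(`GrossLMS1991.prop37_2_reductionCongruence_inert N_E W K`, route item 28665 `Prop37ReductionCongruenceInertAll`).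

WHAT.  The open stub is the positive-depth case of Kolyvagin's `M_∞ = 0` at `2`: on an H₂ frame with
`y_K = P(1) ∈ 2E(K[1])` some square-free product `n` of CM-inert Zhang–Kolyvagin primes has `P(n) ∉ 2E(K[n])`.
The crux's filed worry reads «`y_K` may be `2`-divisible to unbounded depth along `n`».  This file proves the
classical first step of Kolyvagin's descent (Kolyvagin 1991, Thm. 2.2 / McCallum 1991 §5, the proof of Prop. 5.2:
`ord c_M(ℓ)_λ = ord c_M(1)_λ` at a prime `ℓ` chosen by Čebotarev) in the `2`-adic CM-inert setting, where it was
not available: if `2^{M₀} ∥ P(1)` in `E(K[1])` (exact depth `M₀`), then for every `L ≥ M₀ + 1` and every finite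
set `S` of primes to avoid there are a prime `ℓ ∉ S` — a Zhang–Kolyvagin prime at `2` of index `M(ℓ) ≥ L`, INERT
IN THE CM FIELD, with `Frob_ℓ = Frob_∞` on `K(E[2^L])` — and a Kolyvagin–Heegner datum `e` of conductor `ℓ` with
**`P(ℓ) ∉ 2^{M₀+1} E(K[ℓ])`**: the `2`-divisibility depth of the derived point does NOT grow at the first deep
prime (`m(ℓ) ≤ m(1) = M₀`).  At depth `M₀ = 0` this re-proves the crux's conclusion with a PRIME witness level
outside any finite set (`exists_prime_level_witness_of_depth_zero`).

HOW (all inputs are theorems of the tree).  `X = c_L(1) ∈ H¹(K, E[2^L])` has order exactly `2^{L−M₀}`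
(`JET.addOrderOf_kolyvaginClass_of_exactDepth`, admissibility AT `2` `GenusKoly.isAdmissible_pointsSubgroup_two`,
invariance `KolyCert.toGeomPoints_derivedPoint_mem_invPoints_of_dvd_zhang`) and is a `τ`-eigenclass
(`KolyvaginClassSign.sign_conjAct_kolyvaginClass_two`); the full-order pair Čebotarev on H₂
(`KolyvaginImageTwo.infinite_kolyvaginPrime_localization_fullOrder_pair_of_cmInert`, which also yields
`CMInert W ℓ`) gives infinitely many deep primes `ℓ` at whose place `λ` the localisation of `X` keeps the order
`2^{L−M₀}`; compatible data at `ℓ` exist (`JET.exists_compatible_data_of_grossCM`); Kolyvagin's relation at `2`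
(`KolyvaginLowerTwo.kolyvaginRelationAtTwo_at_of_prop37_2`) transports the local orders to `c_L(ℓ)`, so
`2^{L−M₀−1}·c_L(ℓ) ≠ 0`, whence `2^{M₀+1} ∤ P(ℓ)` (`JET.zsmul_kolyvaginClass_eq_zero_iff`).

HONEST RESIDUAL.  The STRICT descent `m(ℓ) < m(1)` when `Ш(E/K)[2] ≠ 0` (McCallum §5 / Kolyvagin Math. Ann. 291,
the pairing step) and its iteration to `M_∞ = 0` are NOT touched: that is the research content of 28177 / 24648.

References: [Kolyvagin1991MathAnn] Thm. 2.2; [McCallumLMS1991] §3 Cor. 3.2, §4 Prop. 4.4, Cor. 4.5, §5 proof of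
Prop. 5.2; [GrossLMS1991] §3 (3.1)–(3.3), Prop. 3.6, Prop. 3.7 (2), Lemma 4.3, §9.
-/

set_option autoImplicit false
-- the Theorems namespace of this sub repeats the summit name by design (D-0017 nested layout)
set_option linter.dupNamespace false

noncomputable section

open scoped Classical

open Field NumberField IsDedekindDomain Function WeierstrassCurve Rat.HeightOneSpectrum
open Literature.NumberTheory.EllipticCurves
open Literature.NumberTheory.EllipticCurves.ModularForms
open Literature.NumberTheory.GaloisRepresentations
open Literature.NumberTheory.GaloisCohomology
open Literature.NumberTheory.EllipticCurves.GrossLMS1991 (prop37_2_reductionCongruence_inert)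
open Summit.BirchSwinnertonDyer.Rank1Residual (X11b.KolyvaginAssembly.discr_lt_neg_four JET.exists_compatible_data_of_grossCM)
open Summit.BirchSwinnertonDyer.BirchSwinnertonDyer.Theorems.GenusExact
open Summit.BirchSwinnertonDyer.BirchSwinnertonDyer.Theorems.GenusExact.VisiblePairAtTwo (exists_natCast_mem)

namespace Summit.BirchSwinnertonDyer.BirchSwinnertonDyer.Theorems.CMKolyvaginFirstDescentTwo

variable (W : WeierstrassCurve ℚ) [W.IsElliptic] [W.IsGloballyMinimal] [NeZero (W.conductorNorm ℤ)]
  {K : Type} [Field K] [NumberField K]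

omit [W.IsElliptic] [W.IsGloballyMinimal] in
/-- Transport of a divisibility certificate along an equality of conductors (`1 * ℓ = ℓ`): a datum of
conductor `a` whose derived point is not `k`-divisible yields one of conductor `b = a`. [folklore] -/
theorem exists_datum_not_dvd_of_eq {Dt : ModularParametrizationData W (W.conductorNorm ℤ)} {β : ℤ} {ι : K →+* ℂ}
    {a b : ℕ} (h : a = b) (e : KolyvaginHeegnerData Dt β ι a) {k : ℤ}
    (he : ¬ ∃ Q : (W.baseChange (ringClassField K ι a)).toAffine.Point, k • Q = e.derivedPoint) :
    ∃ e' : KolyvaginHeegnerData Dt β ι b,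
      ¬ ∃ Q : (W.baseChange (ringClassField K ι b)).toAffine.Point, k • Q = e'.derivedPoint := by
  subst h
  exact ⟨e, he⟩

/-- **KOLYVAGIN'S FIRST DESCENT STEP AT `2` ON H₂ — the depth does not grow (`m(ℓ) ≤ m(1)`).**
`W/ℚ` globally minimal with CM, `2` inert in the CM field, `ρ̄_{E,2}` onto; `K` imaginary quadratic with odd
`d_K ≠ −3` and the Heegner hypothesis; Gross 1991 Prop. 3.7 (2) at `(W, K)` by name; a frame `(Dt, β, ι)` and
a conductor-`1` datum `d₁` of EXACT depth `M₀` (`2^{M₀} ∣ P(1)`, `2^{M₀+1} ∤ P(1)` in `E(K[1])`).  Then for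
every `L ≥ M₀ + 1` and every finite set `S` of naturals there are a prime `ℓ ∉ S`, a Zhang–Kolyvagin prime at
`2` of index `≥ L` with `Frob_ℓ = Frob_∞` on `K(E[2^L])` and `CMInert W ℓ`, and a datum `e` of conductor `ℓ`
with `2^{M₀+1} ∤ P(ℓ)` in `E(K[ℓ])`.  Kolyvagin 1991 Thm. 2.2 / McCallum 1991 §5 (proof of Prop. 5.2), at
`p = 2` on the CM-inert habitat. [cite: McCallumLMS1991, §5 proof of Prop. 5.2; §4 Prop. 4.4, Cor. 4.5; §3 Cor. 3.2]
[cite: Kolyvagin1991MathAnn, Thm. 2.2] [cite: GrossLMS1991, Prop. 3.6, Prop. 3.7 (2), Lemma 4.3] -/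
theorem exists_deep_cmInert_prime_depth_le (hCM : W.HasCM) (hin : Rank1Residual.CMInert W 2)
    (hρ2 : W.HasSurjectiveModNGaloisRep 2)
    (hK : IsImaginaryQuadratic K) (hodd : Odd (NumberField.discr K)) (h3 : NumberField.discr K ≠ -3)
    (hHe : SatisfiesHeegnerHypothesis (W.conductorNorm ℤ) K)
    (h37 : prop37_2_reductionCongruence_inert (W.conductorNorm ℤ) W K)
    (Dt : ModularParametrizationData W (W.conductorNorm ℤ)) (β : ℤ) (ι : K →+* ℂ)
    (d₁ : KolyvaginHeegnerData Dt β ι 1) {M₀ : ℕ}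
    (hdiv : ∃ Q : (W.baseChange (ringClassField K ι 1)).toAffine.Point,
      ((2 ^ M₀ : ℕ) : ℤ) • Q = d₁.derivedPoint)
    (hndiv : ¬ ∃ Q : (W.baseChange (ringClassField K ι 1)).toAffine.Point,
      ((2 ^ (M₀ + 1) : ℕ) : ℤ) • Q = d₁.derivedPoint)
    {L : ℕ} (hL : M₀ + 1 ≤ L) (S : Finset ℕ) :
    ∃ (ℓ : ℕ) (e : KolyvaginHeegnerData Dt β ι ℓ), ℓ.Prime ∧ ℓ ∉ S ∧
      Zhang2014.IsKolyvaginPrime (W.conductorNorm ℤ) W K 2 ℓ ∧ L ≤ Zhang2014.kolyvaginIndex W 2 ℓ ∧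
      FrobEqFrobInfty W K (2 ^ L) ℓ ∧ Rank1Residual.CMInert W ℓ ∧
      ¬ ∃ Q : (W.baseChange (ringClassField K ι ℓ)).toAffine.Point,
        ((2 ^ (M₀ + 1) : ℕ) : ℤ) • Q = e.derivedPoint := by
  haveI : Fact (Nat.Prime 2) := ⟨Nat.prime_two⟩
  have h2K : Module.finrank ℚ K = 2 := hK.1
  have h4 : NumberField.discr K ≠ -4 := fun h ↦ by
    rw [h] at hodd
    exact (Int.not_even_iff_odd.mpr hodd) ⟨-2, by norm_num⟩
  have hD : NumberField.discr K < -4 := X11b.KolyvaginAssembly.discr_lt_neg_four hK ⟨h3, h4⟩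
  have hsurj1 : W.HasSurjectiveModNGaloisRep ((2 : ℤ) ^ 1) := by simpa using hρ2
  have hND : IsCoprime ((W.conductorNorm ℤ : ℕ) : ℤ) (NumberField.discr K) :=
    GenusKoly.heegner_isCoprime_conductorNorm_discr hK hHe
  have hL1 : 1 ≤ L := by omega
  have hM₀L : M₀ ≤ L := by omega
  have hm : 1 ≤ L - M₀ := by omega
  have hn1 : Squarefree 1 := squarefree_one
  have hkol1 : ∀ q ∈ (1 : ℕ).primeFactors,
      Zhang2014.IsKolyvaginPrime (W.conductorNorm ℤ) W K 2 q ∧ L ≤ Zhang2014.kolyvaginIndex W 2 q := by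
    intro q hq
    simp at hq
  -- a non-trivial automorphism of `K`
  obtain ⟨τ, -, hτ, -⟩ := PlusDescent.exists_gal_ne_one_sqrt_discr (K := K) h2K
  -- ### the class `X = c_L(1)` has order exactly `2^{L − M₀}`
  let data₁ : (m : ℕ) → m ∣ 1 → KolyvaginHeegnerData Dt β ι m := fun m hm ↦ (Nat.dvd_one.mp hm).symm ▸ d₁
  have hdata₁ : data₁ 1 dvd_rfl = d₁ := rfl
  have hA : KolyvaginCocycle.IsAdmissible (absoluteGaloisGroup K) d₁.pointsSubgroup ((2 ^ L : ℕ) : ℤ) :=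
    GenusKoly.isAdmissible_pointsSubgroup_two hK hodd hHe hsurj1 one_ne_zero d₁ L
  have hP : d₁.toGeomPoints d₁.derivedPoint ∈
      KolyvaginCocycle.invPoints (absoluteGaloisGroup K) d₁.pointsSubgroup ((2 ^ L : ℕ) : ℤ) := by
    have h := Rank1Residual.X11b.Three.KolyCert.toGeomPoints_derivedPoint_mem_invPoints_of_dvd_zhang hK ι Dt
      Nat.prime_two hND hD hn1 hkol1 data₁ 1 dvd_rfl
    rwa [hdata₁] at h
  set X := d₁.kolyvaginClass Nat.prime_two L with hX_def
  have hXord : addOrderOf X = 2 ^ (L - M₀) :=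
    Rank1Residual.JET.addOrderOf_kolyvaginClass_of_exactDepth d₁ Nat.prime_two hM₀L hA hP hdiv hndiv
  -- ### `X` is a `τ`-eigenclass
  obtain ⟨hsgn, hτX⟩ := KolyvaginClassSign.sign_conjAct_kolyvaginClass_two hK h3 h4 hodd hHe hsurj1 τ hτ Dt β ι
    hn1 hL1 hkol1 d₁
  -- ### the full-order pair Čebotarev on H₂ (pair `(X, X)`), with `CMInert W ℓ`
  have hinf := KolyvaginImageTwo.infinite_kolyvaginPrime_localization_fullOrder_pair_of_cmInert W K hCM hin hρ2
    hK hHe τ hτ L hL1 X X hm hm hXord hXord hsgn hsgn hτX hτX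
  obtain ⟨ℓ, hℓmem, hℓS⟩ := hinf.exists_notMem_finset S
  obtain ⟨hFrob, hKol, hidx, hF, hloc⟩ := hℓmem
  have hℓp : ℓ.Prime := hKol.1
  have hℓ1 : ℓ ∉ (1 : ℕ).primeFactors := by simp
  have hℓdvd : ¬ ℓ ∣ 1 := fun h ↦ hℓp.one_lt.ne' (Nat.dvd_one.mp h)
  have hsq : Squarefree (1 * ℓ) := by rw [one_mul]; exact hℓp.squarefree
  have hall : ∀ q ∈ (1 * ℓ).primeFactors,
      Zhang2014.IsKolyvaginPrime (W.conductorNorm ℤ) W K 2 q ∧ L ≤ Zhang2014.kolyvaginIndex W 2 q := by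
    intro q hq
    rw [one_mul, hℓp.primeFactors, Finset.mem_singleton] at hq
    subst hq
    exact ⟨hKol, hidx⟩
  -- ### a compatible datum at conductor `1 * ℓ`
  obtain ⟨dℓ, hdℓ⟩ := JET.exists_compatible_data_of_grossCM
    (phi_heegnerPointOfConductor_mem_range_map_ringClassField_holds (W.conductorNorm ℤ) W K) hK hD hHe 2 Dt β ι hn1
    (fun q hq ↦ (hkol1 q hq).1) d₁
  obtain ⟨hσc, hS, hS', hemb⟩ := hdℓ ℓ hKol hℓ1
  set e' := dℓ ℓ hKol hℓ1 with he'_def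
  obtain ⟨v, hv⟩ := exists_natCast_mem (K := K) hℓp
  -- ### Kolyvagin's relation at `2` transports the local order of `X` at `λ ∣ ℓ` to `c_L(e')`
  have hQ := KolyvaginLowerTwo.kolyvaginRelationAtTwo_at_of_prop37_2 W Dt β ι hρ2 hK h3 h4 hHe h37 L hsq hℓp hℓdvd
    hall d₁ e' hσc hS hS' hemb v hv (L - M₀ - 1)
  have hXloc : ¬ ((2 ^ (L - M₀ - 1) : ℕ) : ℤ) • X ∈
      (W.baseChange K).torsionLocalKer (v.adicCompletion K) ((2 ^ L : ℕ) : ℤ) := by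
    intro h
    have := ((hloc v hv).1 (L - M₀ - 1)).mp h
    omega
  have hne : ((2 ^ (L - M₀ - 1) : ℕ) : ℤ) • e'.kolyvaginClass Nat.prime_two L ≠ 0 := by
    intro h0
    apply hXloc
    exact hQ.2.mp (by rw [h0]; exact AddSubgroup.zero_mem _)
  have hne0 : e'.kolyvaginClass Nat.prime_two L ≠ 0 := fun h0 ↦ hne (by rw [h0]; exact zsmul_zero _)
  -- ### hence `2^{M₀+1} ∤ P(e')`
  have hnd : ¬ ∃ Q : (W.baseChange (ringClassField K ι (1 * ℓ))).toAffine.Point,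
      ((2 ^ (M₀ + 1) : ℕ) : ℤ) • Q = e'.derivedPoint := by
    rintro ⟨Q, hQ'⟩
    obtain ⟨hA', hP'⟩ := e'.kolyvaginClass_ne_zero hne0
    apply hne
    rw [Rank1Residual.JET.zsmul_kolyvaginClass_eq_zero_iff e' Nat.prime_two L hA' hP']
    refine ⟨Q, ?_⟩
    rw [← hQ', smul_smul, ← Nat.cast_mul, ← pow_add]
    have hLeq : L - M₀ - 1 + (M₀ + 1) = L := by omega
    rw [hLeq]
  obtain ⟨e, he⟩ := exists_datum_not_dvd_of_eq W (one_mul ℓ) e' hnd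
  exact ⟨ℓ, e, hℓp, hℓS, hKol, hidx, hFrob, hF, he⟩

/-- **Depth `0`: the crux's conclusion with a PRIME witness level outside any finite set.**  On the same frame,
if `P(1) = y_K ∉ 2E(K[1])` then for every finite `S` there are a prime `ℓ ∉ S` — a CM-inert Zhang–Kolyvagin prime
at `2` with `Frob_ℓ = Frob_∞` on `K(E[2])` — and a datum `e` of conductor `ℓ` with `P(ℓ) ∉ 2E(K[ℓ])`; in
particular the `∃ (n, d)` clause of `CMKolyvaginConjectureAtInertTwo` holds with `n = ℓ` prime (not only with
`n = 1` as in `stub_levelOne`).  [cite: McCallumLMS1991, §5 proof of Prop. 5.2; Cor. 4.5]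
[cite: GrossLMS1991, Prop. 3.7 (2)] -/
theorem exists_prime_level_witness_of_depth_zero (hCM : W.HasCM) (hin : Rank1Residual.CMInert W 2)
    (hρ2 : W.HasSurjectiveModNGaloisRep 2)
    (hK : IsImaginaryQuadratic K) (hodd : Odd (NumberField.discr K)) (h3 : NumberField.discr K ≠ -3)
    (hHe : SatisfiesHeegnerHypothesis (W.conductorNorm ℤ) K)
    (h37 : prop37_2_reductionCongruence_inert (W.conductorNorm ℤ) W K)
    (Dt : ModularParametrizationData W (W.conductorNorm ℤ)) (β : ℤ) (ι : K →+* ℂ)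
    (d₁ : KolyvaginHeegnerData Dt β ι 1)
    (hndiv : ¬ ∃ Q : (W.baseChange (ringClassField K ι 1)).toAffine.Point, (2 : ℤ) • Q = d₁.derivedPoint)
    (S : Finset ℕ) :
    ∃ (ℓ : ℕ) (e : KolyvaginHeegnerData Dt β ι ℓ), ℓ.Prime ∧ ℓ ∉ S ∧ Squarefree ℓ ∧
      (∀ q ∈ ℓ.primeFactors, Zhang2014.IsKolyvaginPrime (W.conductorNorm ℤ) W K 2 q ∧ Rank1Residual.CMInert W q) ∧
      FrobEqFrobInfty W K (2 ^ 1) ℓ ∧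
      ¬ ∃ Q : (W.baseChange (ringClassField K ι ℓ)).toAffine.Point, (2 : ℤ) • Q = e.derivedPoint := by
  have hdiv : ∃ Q : (W.baseChange (ringClassField K ι 1)).toAffine.Point,
      ((2 ^ 0 : ℕ) : ℤ) • Q = d₁.derivedPoint := ⟨d₁.derivedPoint, by simp⟩
  have hndiv' : ¬ ∃ Q : (W.baseChange (ringClassField K ι 1)).toAffine.Point,
      ((2 ^ (0 + 1) : ℕ) : ℤ) • Q = d₁.derivedPoint := by simpa using hndiv
  obtain ⟨ℓ, e, hℓp, hℓS, hKol, -, hFrob, hF, he⟩ :=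
    exists_deep_cmInert_prime_depth_le W hCM hin hρ2 hK hodd h3 hHe h37 Dt β ι d₁ hdiv hndiv' (L := 1) le_rfl S
  refine ⟨ℓ, e, hℓp, hℓS, hℓp.squarefree, ?_, hFrob, by simpa using he⟩
  intro q hq
  rw [hℓp.primeFactors, Finset.mem_singleton] at hq
  subst hq
  exact ⟨hKol, hF⟩

end Summit.BirchSwinnertonDyer.BirchSwinnertonDyer.Theorems.CMKolyvaginFirstDescentTwo

end
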